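import Literature.Claims.NS.Rozumniuk2019
import Literature.Analysis.FluidPDE.VorticityStretching
import Literature.Analysis.FluidPDE.KNSSLemma31Caloric
import Summits.NavierStokesRegularity.NavierStokesRegularity.Theorems.SoloRefuteTarver2016
import HarnessLib

/-!
# Refutation of the claimed theorem and of Step 1 of Rozumniuk (2019) (NS-claims census C115)

Claim file: `Literature.Claims.NS.Rozumniuk2019` (V. I. Rozumniuk, *On the general solution of the
Navier–Stokes equations* (Ukrainian), 2019, pp.190–193; typed skeleton
`Literature/Claims/NS/Rozumniuk2019.lean`).

**Countermodel (one flow for both faces).** The unsteady linear flow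
`u(t,x) = (x₁ − t·x₂)·e₀ + x₂·e₁`, `p ≡ 0` is an exact smooth solution of (1)–(3) with `f ≡ 0` for every
viscosity: `∂ₜu = −x₂e₀`, `(u·∇)u = x₂e₀`, `Δu = 0`, `div u = 0` (`linFlow_isNS`). Its convective term
`(u·∇)u = x₂e₀` is NOT a gradient — which is what both faces exploit.

* `not_ClaimedTheorem` — **the printed claimed theorem** (`Literature.Claims.NS.Rozumniuk2019.ClaimedTheorem`,
  abstract p.190 / p.193 col.1: every smooth Navier–Stokes solution is `∇ψ + w` with `Δψ = 0` and
  `∂ₜw = νΔw`) fails for this flow: the caloric part `w = u − ∇ψ` would satisfy `Δw = Δu − ∇Δψ = 0`,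
  hence `∂ₜw = 0` for `t > 0`, so `u(2,·) − u(1,·) = −x₂e₀` would be the gradient of the smooth function
  `ψ(2,·) − ψ(1,·)` — impossible (such a potential is constant along `e₂` and drops by `a₂` per unit
  step along `e₀`; compare the steps based at `a = 0` and at `a = e₂`).
* `not_FixedPointLaw` — **Step 1** (`Literature.Claims.NS.Rozumniuk2019.FixedPointLaw`, eq. (8) p.191
  col.2 «∂u/∂t = −∇(H + u²/2)» with the viscous term of (1)): at `t = 0`, `x = e₂` the law demands
  `−e₀ = ∂ₜu = −∇(|u|²/2)(e₂) = −e₂`; pairing with `e₂` gives `0 = −1`.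

A plane-Couette kit against Step 1 by ns-claims-typist-1 g2 (`KillKit-Rozumniuk2019-typist1.lean`)
supplied the idioms (`trace_eq_sum_coord`, the `toDual` pairing); the flow here is different because
Couette flow (`(u·∇)u = 0`) satisfies the claimed split and cannot refute `ClaimedTheorem` (typist-1's
later kit v2 refutes `ClaimedTheorem` independently with the steady flow `x₁e₀ + (x₀ + x₁³/6)e₂`).
The line-derivative lemma `Tarver2016.hasDerivAt_line` is reused from `SoloRefuteTarver2016`.

WHAT THIS IS NOT: not a statement about the Navier–Stokes problem itself; not about any author beyond
the typed locator. Pure calculus; no Navier–Stokes theory is used.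
-/

set_option linter.dupNamespace false

namespace Summit.NavierStokesRegularity.NavierStokesRegularity.Theorems.Rozumniuk2019

open Set InnerProductSpace Literature.Analysis.FluidPDE Literature.Claims.NS.Rozumniuk2019
open scoped RealInnerProductSpace Laplacian ContDiff

noncomputable section

/-- Standard basis vector `e_j` of `ℝ³`. [folklore] -/
abbrev bv (j : Fin 3) : EuclideanSpace ℝ (Fin 3) := EuclideanSpace.single j (1 : ℝ)

/-- Coordinate functional `x ↦ x_j` on `ℝ³`. [folklore] -/
abbrev pr (j : Fin 3) : EuclideanSpace ℝ (Fin 3) →L[ℝ] ℝ := EuclideanSpace.proj j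

/-- The time-`t` slice of the countermodel as a continuous linear map:
`x ↦ (x₁ − t x₂) e₀ + x₂ e₁`. [folklore] -/
def linMap (t : ℝ) : EuclideanSpace ℝ (Fin 3) →L[ℝ] EuclideanSpace ℝ (Fin 3) :=
  (pr 1 - t • pr 2).smulRight (bv 0) + (pr 2).smulRight (bv 1)

/-- The countermodel flow `u(t,x) = (x₁ − t x₂) e₀ + x₂ e₁`. [folklore] -/
def linFlow (t : ℝ) (x : EuclideanSpace ℝ (Fin 3)) : EuclideanSpace ℝ (Fin 3) := linMap t x

/-- Unfolding the flow. [folklore] -/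
theorem linFlow_apply (t : ℝ) (x : EuclideanSpace ℝ (Fin 3)) :
    linFlow t x = (x 1 - t * x 2) • bv 0 + (x 2) • bv 1 := by
  simp [linFlow, linMap]

/-- `D(u(t,·))(x) = linMap t`. [folklore] -/
theorem fderiv_linFlow (t : ℝ) : fderiv ℝ (linFlow t) = fun _ => linMap t :=
  funext fun _ => (linMap t).fderiv

/-- `u(t,·)` is smooth in space (it is linear). [folklore] -/
theorem contDiff_linFlow (t : ℝ) : ContDiff ℝ ∞ (linFlow t) := (linMap t).contDiff

/-- `Δ u(t,·) = 0` (a linear field). [folklore] -/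
theorem laplacian_linFlow (t : ℝ) (x : EuclideanSpace ℝ (Fin 3)) : (Δ (linFlow t)) x = 0 := by
  rw [InnerProductSpace.laplacian_eq_iteratedFDeriv_stdOrthonormalBasis]
  simp [iteratedFDeriv_two_apply, fderiv_linFlow]

/-- The flow is divergence free: `tr (linMap t) = 0`. [folklore] -/
theorem linFlow_divFree (t : ℝ) : NSWave0.IsDivFree (linFlow t) := by
  intro x
  rw [NSWave0.divergence, fderiv_linFlow, trace_eq_sum_coord, Fin.sum_univ_three]
  simp [linMap]

/-- Time derivative of the flow at a fixed point: `∂ₜu(t,x) = −x₂ e₀`. [folklore] -/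
theorem hasDerivAt_linFlow (t : ℝ) (x : EuclideanSpace ℝ (Fin 3)) :
    HasDerivAt (fun s => linFlow s x) (-(x 2) • bv 0) t := by
  have h1 : HasDerivAt (fun s : ℝ => x 1 - s * x 2) (-(x 2)) t := by
    simpa using ((hasDerivAt_id t).mul_const (x 2)).const_sub (x 1)
  have h2 := (h1.smul_const (bv 0)).add_const ((x 2) • bv 1)
  simp only [linFlow_apply]
  exact h2

/-- The flow is smooth on `ℝ³ × [0,∞)` (it is polynomial in `(t,x)`). [folklore] -/
theorem linFlow_smooth : IsSmoothOnHalfSpace linFlow := by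
  have e : Function.uncurry linFlow = fun q : ℝ × EuclideanSpace ℝ (Fin 3) =>
      (pr 1 q.2 - q.1 * pr 2 q.2) • bv 0 + (pr 2 q.2) • bv 1 := by
    funext q; exact linFlow_apply q.1 q.2
  have h1 : ContDiff ℝ ∞ (fun q : ℝ × EuclideanSpace ℝ (Fin 3) => pr 1 q.2) :=
    (pr 1).contDiff.comp contDiff_snd
  have h2 : ContDiff ℝ ∞ (fun q : ℝ × EuclideanSpace ℝ (Fin 3) => pr 2 q.2) :=
    (pr 2).contDiff.comp contDiff_snd
  have h : ContDiff ℝ ∞ (Function.uncurry linFlow) := by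
    rw [e]
    exact ((h1.sub (contDiff_fst.mul h2)).smul contDiff_const).add (h2.smul contDiff_const)
  exact h.contDiffOn

/-- **The flow with zero pressure solves (1)–(3) with `f ≡ 0`** for every viscosity:
`∂ₜu + (u·∇)u = −x₂e₀ + x₂e₀ = 0 = νΔu − ∇0`. [folklore] -/
theorem linFlow_isNS (ν : ℝ) : IsNavierStokesSolution ν 0 (linFlow 0) linFlow (fun _ _ => 0) := by
  refine ⟨fun t ht x => ?_, fun t _ => linFlow_divFree t, rfl⟩
  rw [(hasDerivAt_linFlow t x).hasDerivWithinAt.derivWithin (uniqueDiffOn_Ici 0 t ht),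
    fderiv_linFlow, laplacian_linFlow]
  have h4 : gradient (fun _ : EuclideanSpace ℝ (Fin 3) => (0 : ℝ)) x = 0 := by simp [gradient]
  rw [h4]
  ext i
  fin_cases i <;> simp [linMap, linFlow]

/-! ## Face 1: the claimed potential–caloric split fails -/

/-- A function smooth on the closed half-space has smooth time slices at `t ≥ 0`. [folklore] -/
theorem contDiff_slice {F : Type*} [NormedAddCommGroup F] [NormedSpace ℝ F]
    {P : ℝ → EuclideanSpace ℝ (Fin 3) → F} (hP : IsSmoothOnHalfSpace P) {t : ℝ} (ht : 0 ≤ t) :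
    ContDiff ℝ ∞ (P t) := by
  have hmap : MapsTo (fun x : EuclideanSpace ℝ (Fin 3) => (t, x)) univ
      (Ici (0 : ℝ) ×ˢ (univ : Set (EuclideanSpace ℝ (Fin 3)))) := fun x _ => ⟨ht, mem_univ _⟩
  have hc : ContDiffOn ℝ ∞ (fun x : EuclideanSpace ℝ (Fin 3) => Function.uncurry P (t, x)) univ :=
    hP.comp (contDiff_prodMk_right t).contDiffOn hmap
  simpa [Function.uncurry, contDiffOn_univ] using hc

/-- A function smooth on the closed half-space is differentiable in time at every `t > 0`, `x` fixed.
[folklore] -/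
theorem differentiableAt_time {F : Type*} [NormedAddCommGroup F] [NormedSpace ℝ F]
    {P : ℝ → EuclideanSpace ℝ (Fin 3) → F} (hP : IsSmoothOnHalfSpace P) {t : ℝ} (ht : 0 < t)
    (x : EuclideanSpace ℝ (Fin 3)) : DifferentiableAt ℝ (fun s => P s x) t := by
  have hmem : Ici (0 : ℝ) ×ˢ (univ : Set (EuclideanSpace ℝ (Fin 3))) ∈ nhds (t, x) :=
    prod_mem_nhds (Ici_mem_nhds ht) Filter.univ_mem
  have hd : DifferentiableAt ℝ (Function.uncurry P) (t, x) :=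
    (hP.contDiffAt hmem).differentiableAt (by simp)
  have e : (fun s => P s x) = Function.uncurry P ∘ fun s => (s, x) := by funext s; rfl
  rw [e]
  exact hd.comp t (differentiableAt_id.prodMk (differentiableAt_const x))

/-- `(toDual)⁻¹ : (ℝ³)^* → ℝ³` as a continuous linear map (so that `∇ψ = (toDual)⁻¹ ∘ Dψ`). [folklore] -/
abbrev dualInv : StrongDual ℝ (EuclideanSpace ℝ (Fin 3)) →L[ℝ] EuclideanSpace ℝ (Fin 3) :=
  ((toDual ℝ (EuclideanSpace ℝ (Fin 3))).symm :
    StrongDual ℝ (EuclideanSpace ℝ (Fin 3)) →L[ℝ] EuclideanSpace ℝ (Fin 3))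

/-- `∇ψ = (toDual)⁻¹ ∘ Dψ`. [folklore] -/
theorem gradient_eq_comp (ψ : EuclideanSpace ℝ (Fin 3) → ℝ) : gradient ψ = ⇑dualInv ∘ fderiv ℝ ψ := by
  funext y; rfl

/-- The gradient of a smooth function is smooth. [folklore] -/
theorem contDiff_gradient {ψ : EuclideanSpace ℝ (Fin 3) → ℝ} (hψ : ContDiff ℝ ∞ ψ) :
    ContDiff ℝ ∞ (gradient ψ) := by
  rw [gradient_eq_comp]
  exact dualInv.contDiff.comp (hψ.fderiv_right (m := ∞) (by norm_cast))

/-- The gradient of a harmonic smooth function is (vector-)harmonic: `Δ(∇ψ) = ∇(Δψ) = 0`. [folklore] -/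
theorem laplacian_gradient_eq_zero {ψ : EuclideanSpace ℝ (Fin 3) → ℝ} (hψ : ContDiff ℝ ∞ ψ)
    (hharm : ∀ x, (Δ ψ) x = 0) (x : EuclideanSpace ℝ (Fin 3)) : (Δ (gradient ψ)) x = 0 := by
  have h3 : ContDiff ℝ 3 ψ := hψ.of_le (by norm_cast)
  have hD : ContDiffAt ℝ 2 (fderiv ℝ ψ) x := (hψ.fderiv_right (m := 2) (by norm_cast)).contDiffAt
  rw [gradient_eq_comp, hD.laplacian_CLM_comp_left, Function.comp_apply,
    laplacian_fderiv_eq_fderiv_laplacian h3]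
  have hz : (Δ ψ) = fun _ => (0 : ℝ) := funext hharm
  rw [hz]
  simp

/-- The obstruction: no differentiable `Q : ℝ³ → ℝ` has gradient `x ↦ −x₂ e₀`
(`∂₂` of the `e₀`-component is `−1`, `∂₀` of the `e₂`-component is `0`). [folklore] -/
theorem no_potential_linear {Q : EuclideanSpace ℝ (Fin 3) → ℝ} (hQ : Differentiable ℝ Q)
    (hgrad : ∀ x : EuclideanSpace ℝ (Fin 3), gradient Q x = -(x 2) • bv 0) : False := by
  -- (i) `Q` is constant along `e₂`
  have hconst : ∀ (a : EuclideanSpace ℝ (Fin 3)) (s : ℝ), Q (a + s • bv 2) = Q a := by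
    intro a s
    have hF : ∀ r : ℝ, HasDerivAt (fun r : ℝ => Q (a + r • bv 2)) 0 r := fun r => by
      convert Tarver2016.hasDerivAt_line hQ a (bv 2) r using 1
      rw [hgrad]
      simp [EuclideanSpace.inner_single_right]
    simpa using is_const_of_deriv_eq_zero (fun r => (hF r).differentiableAt)
      (fun r => (hF r).deriv) s 0
  -- (ii) along `e₀`: `Q(a + s e₀) = Q(a) − a₂ s`
  have hlin : ∀ (a : EuclideanSpace ℝ (Fin 3)) (s : ℝ), Q (a + s • bv 0) = Q a - a 2 * s := by
    intro a s
    have hF : ∀ r : ℝ, HasDerivAt (fun r : ℝ => Q (a + r • bv 0) + a 2 * r) 0 r := fun r => by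
      have h12 : HasDerivAt (fun r : ℝ => Q (a + r • bv 0) + a 2 * r)
          (⟪gradient Q (a + r • bv 0), bv 0⟫ + a 2) r :=
        (Tarver2016.hasDerivAt_line hQ a (bv 0) r).fun_add (by simpa using (hasDerivAt_id r).const_mul (a 2))
      convert h12 using 1
      rw [hgrad]
      simp [EuclideanSpace.inner_single_right, inner_neg_left]
    have := is_const_of_deriv_eq_zero (fun r => (hF r).differentiableAt) (fun r => (hF r).deriv) s 0
    simp only [zero_smul, add_zero, mul_zero] at this
    linarith
  have hA : Q (bv 0) = Q 0 := by simpa using hlin 0 1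
  have hB : Q (bv 2 + bv 0) = Q (bv 2) - 1 := by simpa using hlin (bv 2) 1
  have hC : Q (bv 0 + bv 2) = Q (bv 0) := by simpa using hconst (bv 0) 1
  have hD : Q (bv 2) = Q 0 := by simpa using hconst 0 1
  rw [add_comm] at hC
  linarith [hA, hB, hC, hD]

/-- **`¬ ClaimedTheorem`** — the printed representation claim fails for the linear flow: the split
`u = ∇ψ + w`, `Δψ = 0`, `∂ₜw = νΔw` would force `Δw = 0`, `∂ₜw = 0` on `t > 0`, hence
`u(2,·) − u(1,·) = −x₂e₀ = ∇(ψ(2,·) − ψ(1,·))`, which `no_potential_linear` forbids. [folklore] -/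
theorem not_ClaimedTheorem : ¬ Literature.Claims.NS.Rozumniuk2019.ClaimedTheorem := by
  intro h
  obtain ⟨ψ, w, hψ, hw, hsplit, hharm, hheat⟩ :=
    h 1 (linFlow 0) linFlow (fun _ _ => 0) one_pos linFlow_smooth contDiffOn_const (linFlow_isNS 1)
  -- smooth slices of `ψ`
  have hψs : ∀ t : ℝ, 0 ≤ t → ContDiff ℝ ∞ (ψ t) := fun t ht => contDiff_slice hψ ht
  -- `w t = u t − ∇ψ t` as functions, for `t ≥ 0`
  have hw_eq : ∀ t : ℝ, 0 ≤ t → w t = linFlow t - gradient (ψ t) := by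
    intro t ht; funext x
    rw [Pi.sub_apply, hsplit t ht x]
    abel
  -- `Δ (w t) = 0` for `t > 0`
  have hlapw : ∀ t : ℝ, 0 < t → ∀ x, (Δ (w t)) x = 0 := by
    intro t ht x
    have hf : ContDiffAt ℝ 2 (linFlow t) x := ((contDiff_linFlow t).of_le (by norm_cast)).contDiffAt
    have hg : ContDiffAt ℝ 2 (gradient (ψ t)) x :=
      ((contDiff_gradient (hψs t ht.le)).of_le (by norm_cast)).contDiffAt
    rw [hw_eq t ht.le, hf.laplacian_sub hg, laplacian_linFlow,
      laplacian_gradient_eq_zero (hψs t ht.le) (hharm t ht.le), sub_zero]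
  -- hence `∂ₜ w(·, x) = 0` on `t > 0`, so `w 2 x = w 1 x`
  have hwconst : ∀ x, w 2 x = w 1 x := by
    intro x
    have hderiv : ∀ t : ℝ, 0 < t → HasDerivAt (fun s => w s x) 0 t := by
      intro t ht
      have hd := (differentiableAt_time hw ht x).hasDerivAt
      rw [hheat t ht x, hlapw t ht x, smul_zero] at hd
      exact hd
    have hcont : ContinuousOn (fun s => w s x) (Icc 1 2) := fun s hs =>
      (hderiv s (by linarith [hs.1])).continuousAt.continuousWithinAt
    exact constant_of_has_deriv_right_zero hcont
      (fun s hs => (hderiv s (by linarith [hs.1])).hasDerivWithinAt) 2 ⟨by norm_num, le_rfl⟩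
  -- the difference of the potentials has gradient `−x₂ e₀`
  have hgrad : ∀ x : EuclideanSpace ℝ (Fin 3),
      gradient (fun y => ψ 2 y - ψ 1 y) x = -(x 2) • bv 0 := by
    intro x
    have h2 := hsplit 2 (by norm_num) x
    have h1 := hsplit 1 (by norm_num) x
    rw [hwconst x] at h2
    have hd2 : DifferentiableAt ℝ (ψ 2) x := ((hψs 2 (by norm_num)).differentiable (by simp)) x
    have hd1 : DifferentiableAt ℝ (ψ 1) x := ((hψs 1 (by norm_num)).differentiable (by simp)) x
    have hsub : gradient (fun y => ψ 2 y - ψ 1 y) x = gradient (ψ 2) x - gradient (ψ 1) x := by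
      simp only [gradient]
      rw [fderiv_fun_sub hd2 hd1, map_sub]
    have e12 : gradient (ψ 2) x - gradient (ψ 1) x = linFlow 2 x - linFlow 1 x := by
      rw [h2, h1]; abel
    rw [hsub, e12, linFlow_apply, linFlow_apply]
    module
  have hQ : Differentiable ℝ (fun y => ψ 2 y - ψ 1 y) :=
    ((hψs 2 (by norm_num)).differentiable (by simp)).sub
      ((hψs 1 (by norm_num)).differentiable (by simp))
  exact no_potential_linear hQ hgrad

/-! ## Face 2: Step 1, eq. (8) -/

/-- The Bernoulli-type function of (8) for the flow at `t = 0`: `p + |u|²/2 = (x₁² + x₂²)/2`. [folklore] -/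
theorem bernoulli_linFlow_zero :
    (fun y : EuclideanSpace ℝ (Fin 3) => (fun _ _ => (0 : ℝ)) (0 : ℝ) y + ‖linFlow 0 y‖ ^ 2 / 2) =
      fun y : EuclideanSpace ℝ (Fin 3) => (1 / 2 : ℝ) * (pr 1 y * pr 1 y + pr 2 y * pr 2 y) := by
  funext y
  rw [linFlow_apply, EuclideanSpace.norm_sq_eq]
  simp [Fin.sum_univ_three]
  ring

/-- Its derivative at `x` in the direction `e₂` is `x₂`. [folklore] -/
theorem fderiv_bernoulli_bv2 (x : EuclideanSpace ℝ (Fin 3)) :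
    fderiv ℝ (fun y : EuclideanSpace ℝ (Fin 3) => (1 / 2 : ℝ) * (pr 1 y * pr 1 y + pr 2 y * pr 2 y)) x
      (bv 2) = x 2 := by
  have h1 : HasFDerivAt (fun y : EuclideanSpace ℝ (Fin 3) => pr 1 y) (pr 1) x := (pr 1).hasFDerivAt
  have h2 : HasFDerivAt (fun y : EuclideanSpace ℝ (Fin 3) => pr 2 y) (pr 2) x := (pr 2).hasFDerivAt
  rw [(((h1.fun_mul h1).fun_add (h2.fun_mul h2)).const_mul (1 / 2 : ℝ)).fderiv]
  simp
  ring

/-- **`¬ FixedPointLaw`** (eq. (8) with the viscous term): for the linear flow at `t = 0`, `x = e₂`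
the law reads `−e₀ = −∇((x₁² + x₂²)/2)(e₂) = −e₂`; pairing with `e₂` gives `0 = −1`. [folklore] -/
theorem not_FixedPointLaw : ¬ Literature.Claims.NS.Rozumniuk2019.FixedPointLaw := by
  intro h
  have key := h 1 (linFlow 0) linFlow (fun _ _ => 0) one_pos linFlow_smooth contDiffOn_const
    (linFlow_isNS 1) 0 le_rfl (bv 2)
  rw [(hasDerivAt_linFlow 0 (bv 2)).hasDerivWithinAt.derivWithin (uniqueDiffOn_Ici 0 0 self_mem_Ici),
    laplacian_linFlow, bernoulli_linFlow_zero] at key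
  -- pair both sides with `e₂`
  have hk := congrArg (fun v : EuclideanSpace ℝ (Fin 3) => ⟪v, bv 2⟫) key
  simp only [smul_zero, add_zero, inner_neg_left] at hk
  rw [gradient, InnerProductSpace.toDual_symm_apply, fderiv_bernoulli_bv2] at hk
  simp [EuclideanSpace.inner_single_left] at hk

end

end Summit.NavierStokesRegularity.NavierStokesRegularity.Theorems.Rozumniuk2019
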